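import Summits.KontsevichZagierPeriods.Zeta5Search.PermutationSavingForms28
import HarnessLib.Audit
import HarnessLib

/-!
# ζ(5) search — the FLAT (cone-free) `S₇`-gauge law: Brown–Zudilin's `D` with fifth modulus `max(m₅, ⌊d/2⌋)` (fam-rv gen-4)

HONEST FRAMING: systematic search; no irrationality claim unless certified.

Cell `pub-zeta5`, family-designer seat `pub-zeta5-fam-rv-g4` (Rhin–Viola permutation-group refinements, gen 4,
2026-08-20).  Staged at `HOME/pub-zeta5-fam-rv/gen4/lean/RVFlatGauge.lean`; proposed tree target
`Summits/KontsevichZagierPeriods/Zeta5Search/RVFlatGauge.lean` (filing by a permitted lane; planner seats have no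
Zeta5Search stage permission).

WHAT THIS FILE IS.  The tree's `S₇`-gauge law (`SymmetricGauge.SymmetricGaugeLaw`, = `PhiSaving`, = Brown–Zudilin
(28)+(29)+(30) for `Pₙ` on the dual side) and its `σ = 1` case `GaugeLaw28` carry the CONE hypothesis `d(b) ≤ 2·m₅(b)`
(v2, gen-2 g9 / census g13): off that cone (28) as printed FAILS, always with margin exactly `1`, at primes `p` with
`2p ≤ d(b)` (gen-2 g9's 28 witnesses; census g13: 384 violations in 34 984 off-cone instances, min margin `−1`;
`XSaveConjectures.XS2_failsBeyondTwiceM1` / `witness28`: the denominators of `P(a·n)` live on the prime window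
`(m₁n, Dn/2]`).  The Rhin–Viola method needs a basic inclusion that is UNIFORM IN THE PARAMETERS (it is applied at every
point of the `S₇`-orbit, cf. `symmetricGaugeLaw_of_gaugeLaw28_holds`), and a proof of (28) from the cellular integral —
"in principle possible, with considerable effort" (BZ22 Remark before (28), arXiv:2210.03391v3 p. 20) — cannot see a cone.
So the statement to aim at is the uniform one.  THIS FILE TYPES IT:

  (FLAT)  `v_p(Cas_j(b)) ≥ −e_D♭(b,p) − v_p(ρ(σ•b))`  for EVERY `b` in the polytope (no cone), every `σ ∈ S₇`, `p ≥ 5`, `p² > m₁(b)`,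

with `e_D♭(b,p) = Σ_{i≤4} ⌊log_p m_i⌋ + ⌊log_p m₅♭⌋`, **`m₅♭(b) := max(m₅(b), ⌊d(b)/2⌋)`** (`m5flat`, `eDflat`): Brown–Zudilin's
`D = d_{m₁}⋯d_{m₅}` with its least modulus replaced by `max(m₅, ⌊d/2⌋)`, where `d = 3b₀ − Σbᵢ = |h₂₉|` is the 29th
`S₇`-invariant linear form of BZ22 (26)–(27) ("one additional hyperplane … also preserved", p. 19; `WedgeDictionary.dOf`,
fam-rv gen-1 `RVCosetLemma`: `dOf ∘ bOfA = −h₂₉`).  ON the cone `m₅♭ = m₅` and (FLAT) is the tree's v2 law verbatim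
(`eDflat_eq_eD_of_cone`, `symmetricGaugeLaw_of_flatGaugeLaw`, `gaugeLaw28_of_flatGaugeLaw28` — PROVED); OFF the cone it
charges exactly one more unit at the primes `m₅ < p ≤ d/2` (and at `p ≤ m₅` with `p² ≤ ⌊d/2⌋`), which is where and by
how much (28) fails.

PROVED HERE (0 sorries): the bookkeeping `eD_le_eDflat` ((FLAT) is pointwise WEAKER than extending v2 off the cone, equal on
it), the cone reductions, and the RHIN–VIOLA TRANSPORT for the flat law — `flatGaugeLaw_of_flatGaugeLaw28 :
FlatGaugeLaw28 → FlatGaugeLaw` (the `σ = 1` law at every labelling + the `S₇`-equivariance of the Casoratian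
`casoratianPermSymmetry_holds` + invariance of `d, m₅, e_D` `gaugeDataPermInvariant_holds` ⟹ the law in every gauge; same
skeleton as `symmetricGaugeLaw_of_gaugeLaw28`), hence `phiSaving_of_flatGaugeLaw28 : FlatGaugeLaw28 → PhiSaving`.
NOT proved: (FLAT) itself — `FlatGaugeLaw`, `FlatGaugeLaw28` are statements MINTED BY THIS CELL (`@[conjecture]`), OBSERVED.

EVIDENCE (fam-rv gen-4 `HOME/pub-zeta5-fam-rv/gen4/rv4_flatcone.py`, exact arithmetic, engine = census g13 `gaugecone`
(gen-1 `dictionary.forms_dual`) with fam-rv's independent evaluator `implC_pf` agreeing on a sub-sample; random `b` in the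
polytope with RANDOM labelling, 85 % of the sample drawn OFF the cone, random admissible `j`, every prime `5 ≤ p ≤ 3b₀+8`;
outputs `gen4/out/flatcone_*.json`): the numbers are quoted in `HOME/families/rv/FAMILY.md` §14 next to this file's sha —
(FLAT): 0 violations in every zone (cone / `2m₅ < d ≤ 2m₁` / `d > 2m₁`), tight (equality) in ≈ 90 % of instances; the
v2 bound extended off the cone: violated with margin exactly `−1`, every violation at a prime with `2p ≤ d`, and (FLAT) is
TIGHT at every one of them; the discriminators `m₅ ↦ max(m₅, d − m₁)` and "six largest forms" (the `(9.3)+S₇` shape) FAIL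
off the cone, `e_D + [2p ≤ d]` holds but is slack on the cone.  Kernel instances below: the record ray (inside the cone,
`e_D♭ = e_D`), gen-2 g9's first witness `bW1 = (15; 4,4,3,3,3,1,0)` at `p = 13` (`e_D = 1`, `e_D♭ = 2` = the missing unit),
and the dual vector `(53; 6,5,4,3,2,1,0)` of `XSaveConjectures.witness28` (`p = 53, 59, 61, 67 ≤ d/2 = 69` get the unit,
`p = 71` does not — matching the census's list of primes dividing `den P(a)` there).

VALUE (numbers, not adjectives).  On the record ray and on every NEAR-MISSES ray the cone holds, so (FLAT) certifies
nothing new there (Δγ = 0); its content is (i) the correct UNIFORM target for the basic inclusion that the Rhin–Viola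
transport consumes (T3: typed statement), (ii) the identification of the 29th invariant form `d` as the carrier of the
off-cone denominators (`max(m₅, d/2)`, not a sixth lcm), (iii) a cone-free conjecture base: `FlatGaugeLaw28` ⟹ `GaugeLaw28`,
`SymmetricGaugeLaw`, `PhiSaving` (all PROVED implications), so a typer proving (FLAT) in any one gauge closes the whole
(28)–(30) node (census: `PhiSaving` = the last 1.370 nats/step of the record's gap, γ 0.85725 → 0.86597).
-/

namespace Summit.KontsevichZagierPeriods.Zeta5Search.RVFlatGauge

open Finset
open Summit.KontsevichZagierPeriods.Zeta5Search.CasoratianValuation (casoratian shift InPolytope)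
open Summit.KontsevichZagierPeriods.Zeta5Search.WedgeDictionary (dOf)
open Summit.KontsevichZagierPeriods.Zeta5Search.SymmetricGauge

/-! ### The flat fifth modulus and exponent -/

/-- `m₅♭(b) = max(m₅(b), ⌊d(b)/2⌋)` — Brown–Zudilin's least `D`-modulus made uniform by the 29th invariant form `d`. -/
def m5flat (b : ℕ → ℤ) : ℤ := max (m5 b) (dOf b / 2)

/-- `e_D♭(b,p) = e_D(b,p) − ⌊log_p m₅⌋ + ⌊log_p m₅♭⌋ = Σ_{i≤4} ⌊log_p m_i⌋ + ⌊log_p max(m₅, ⌊d/2⌋)⌋`. -/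
def eDflat (b : ℕ → ℤ) (p : ℕ) : ℤ :=
  eD b p - (Nat.log p (m5 b).toNat : ℤ) + (Nat.log p (m5flat b).toNat : ℤ)

/-- `m₅ ≤ m₅♭`. -/
theorem m5_le_m5flat (b : ℕ → ℤ) : m5 b ≤ m5flat b := le_max_left _ _

/-- (FLAT) never charges less than `e_D`: `e_D ≤ e_D♭`. -/
theorem eD_le_eDflat (b : ℕ → ℤ) (p : ℕ) : eD b p ≤ eDflat b p := by
  have h : Nat.log p (m5 b).toNat ≤ Nat.log p (m5flat b).toNat :=
    Nat.log_mono_right (by have := m5_le_m5flat b; omega)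
  unfold eDflat; omega

/-- On the v2 cone `d ≤ 2m₅` the flat modulus is `m₅`. -/
theorem m5flat_eq_m5_of_cone {b : ℕ → ℤ} (hd : dOf b ≤ 2 * m5 b) : m5flat b = m5 b := by
  unfold m5flat; exact max_eq_left (by omega)

/-- On the v2 cone `e_D♭ = e_D`. -/
theorem eDflat_eq_eD_of_cone {b : ℕ → ℤ} (p : ℕ) (hd : dOf b ≤ 2 * m5 b) : eDflat b p = eD b p := by
  simp [eDflat, m5flat_eq_m5_of_cone hd]

/-- The flat data are `S₇`-invariant (from `gaugeDataPermInvariant_holds`: `d`, `m₅`, `e_D` are). -/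
theorem eDflat_permLower (σ : Equiv.Perm (Fin 7)) (b : ℕ → ℤ) (p : ℕ) :
    eDflat (permLower σ b) p = eDflat b p := by
  obtain ⟨_, hd, _, hm5, heD⟩ := gaugeDataPermInvariant_holds b σ
  simp only [eDflat, m5flat, hd, hm5, heD]

/-! ### The statements (OBSERVED; minted by this cell) -/

/-- **(FLAT), OBSERVED — the cone-free `S₇`-gauge law.**  For EVERY `b` in the polytope (no cone hypothesis), a contiguity
index `j` keeping `b + e_j` in the polytope, a prime `p ≥ 5` with `p² > m₁(b)`, and every `σ ∈ S₇`:
`v_p(Cas_j(b)) ≥ −e_D♭(b,p) − v_p(ρ(σ•b))`.  Equal to `SymmetricGaugeLaw` on the cone (`symmetricGaugeLaw_of_flatGaugeLaw`). -/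
@[conjecture] def FlatGaugeLaw : Prop :=
  ∀ (b : ℕ → ℤ) (j p : ℕ) (σ : Equiv.Perm (Fin 7)),
    InPolytope b → 1 ≤ j → j ≤ 7 → InPolytope (shift b j) →
    p.Prime → 5 ≤ p → m1 b < (p : ℤ) ^ 2 → casoratian b j ≠ 0 →
      -eDflat b p - padicValRat p (rhoB (permLower σ b)) ≤ padicValRat p (casoratian b j)

/-- **(FLAT-28), OBSERVED — the flat law in ONE (every) labelling, `σ = 1`, no restriction `p² > m₁`:**
`v_p(Cas_j(b)) ≥ −e_D♭(b,p) − v_p(ρ(b))`, i.e. `d_{m₁}d_{m₂}d_{m₃}d_{m₄}d_{max(m₅,⌊d/2⌋)} · P ∈ ℤ_(p)` for `P = ρ(b)·Cas_j(b)`,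
`p ≥ 5`, for every `b` in the polytope.  This is the UNIFORM basic inclusion a proof of (28) from the cellular integral
would have to deliver; by `flatGaugeLaw_of_flatGaugeLaw28` it already carries the whole permutation-group saving. -/
@[conjecture] def FlatGaugeLaw28 : Prop :=
  ∀ (b : ℕ → ℤ) (j p : ℕ),
    InPolytope b → 1 ≤ j → j ≤ 7 → InPolytope (shift b j) →
    p.Prime → 5 ≤ p → casoratian b j ≠ 0 →
      -eDflat b p - padicValRat p (rhoB b) ≤ padicValRat p (casoratian b j)

/-! ### PROVED: cone reductions -/

/-- (FLAT) restricted to the cone IS the tree's `SymmetricGaugeLaw`. -/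
theorem symmetricGaugeLaw_of_flatGaugeLaw (h : FlatGaugeLaw) : SymmetricGaugeLaw := by
  intro b j p σ hb hj1 hj7 hb' hd hp h5 hm hne
  have key := h b j p σ hb hj1 hj7 hb' hp h5 hm hne
  rwa [eDflat_eq_eD_of_cone p hd] at key

/-- (FLAT-28) restricted to the cone IS the tree's `GaugeLaw28`. -/
theorem gaugeLaw28_of_flatGaugeLaw28 (h : FlatGaugeLaw28) : GaugeLaw28 := by
  intro b j p hb hj1 hj7 hb' hd hp h5 hne
  have key := h b j p hb hj1 hj7 hb' hp h5 hne
  rwa [eDflat_eq_eD_of_cone p hd] at key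

/-! ### PROVED: the Rhin–Viola transport for the flat law

The basic inclusion in every labelling (`FlatGaugeLaw28` quantifies over all `b : ℕ → ℤ`, hence over `σ•b`) plus the
`S₇`-equivariance of the Casoratian gives the law in every gauge — Brown–Zudilin's passage (28) ⟹ (29)–(30), now for the
uniform statement (no cone to transport). -/

/-- **`FlatGaugeLaw28 → FlatGaugeLaw`** (transport along the `S₇`-orbit). -/
theorem flatGaugeLaw_of_flatGaugeLaw28 (h28 : FlatGaugeLaw28) : FlatGaugeLaw := by
  intro b j p σ hb hj1 hj7 hb' hp h5 _hm hne
  obtain ⟨hP, _hdOf, _hm1, _hm5, _heD⟩ := gaugeDataPermInvariant_holds b σ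
  -- the index `i` with `σ(i)+1 = j`
  set i : Fin 7 := σ.symm ⟨j - 1, by omega⟩ with hi
  have hσi : (σ i).val + 1 = j := by simp [hi]; omega
  have hcas : casoratian (permLower σ b) (i.val + 1) = casoratian b j := by
    rw [casoratianPermSymmetry_holds b σ i, hσi]
  have hshift : InPolytope (shift (permLower σ b) (i.val + 1)) := by
    rw [shift_permLower, hσi]; exact (gaugeDataPermInvariant_holds (shift b j) σ).1 hb'
  have hne' : casoratian (permLower σ b) (i.val + 1) ≠ 0 := by rw [hcas]; exact hne
  have key := h28 (permLower σ b) (i.val + 1) p (hP hb) (by omega) (by have := i.isLt; omega) hshift hp h5 hne'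
  rw [hcas, eDflat_permLower] at key
  exact key

/-- Hence the flat law in one labelling gives the tree's whole (28)–(30) node. -/
theorem symmetricGaugeLaw_of_flatGaugeLaw28 (h28 : FlatGaugeLaw28) : SymmetricGaugeLaw :=
  symmetricGaugeLaw_of_flatGaugeLaw (flatGaugeLaw_of_flatGaugeLaw28 h28)

/-- … and Brown–Zudilin's permutation-group saving in its own shape. -/
theorem phiSaving_of_flatGaugeLaw28 (h28 : FlatGaugeLaw28) : PhiSaving :=
  phiSaving_iff_symmetricGaugeLaw.2 (symmetricGaugeLaw_of_flatGaugeLaw28 h28)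

/-! ### Kernel instances -/

/-- On the record `b = (41; 17,…,11)` (inside the cone, `d = 25 ≤ 32`): `m₅♭ = m₅ = 16`, `e_D♭ = e_D` at `p = 5, 17`. -/
example : m5flat bRecord = 16 ∧ eDflat bRecord 5 = eD bRecord 5 ∧ eDflat bRecord 17 = eD bRecord 17 := by decide

/-- gen-2 g9's first witness `bW1 = (15; 4,4,3,3,3,1,0)` (`d = 27 > 22 = 2m₅`): at `p = 13 ∈ (m₅, d/2] = (11, 13]` the flat
law charges the missing unit: `e_D = 1`, `e_D♭ = 2`; at `p = 11 = m₅` nothing changes. -/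
example : m5flat bW1 = 13 ∧ eD bW1 13 = 1 ∧ eDflat bW1 13 = 2 ∧ eDflat bW1 11 = eD bW1 11 := by decide

/-- The dual vector of `XSaveConjectures.witness28` (`a = (42,5,44,4,46,50,52,47)`): `b = (53; 6,5,4,3,2,1,0)`, `m₁ = 52`,
`d = 138`, `m₅♭ = 69`; the census found `53, 59, 61, 67 ∣ den P(a)` — exactly the primes of `(m₁, d/2]`, each charged one
unit by `e_D♭` and none by `e_D`; `71 > d/2` is charged by neither. -/
def bXS : ℕ → ℤ := fun i => (([53, 6, 5, 4, 3, 2, 1, 0] : List ℤ).getD i 0)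
example : m1 bXS = 52 ∧ dOf bXS = 138 ∧ m5flat bXS = 69 ∧
    eD bXS 53 = 0 ∧ eDflat bXS 53 = 1 ∧ eDflat bXS 59 = 1 ∧ eDflat bXS 61 = 1 ∧ eDflat bXS 67 = 1 ∧
    eDflat bXS 71 = 0 := by decide

end Summit.KontsevichZagierPeriods.Zeta5Search.RVFlatGauge
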